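import Literature.NumberTheory.DiophantineGeometry.CatalanSemisimple
import Literature.NumberTheory.NumberFields.UnitGaloisTrace
import Literature.NumberTheory.DiophantineGeometry.CatalanMinusPower
import Mathlib.NumberTheory.NumberField.Cyclotomic.Embeddings
import HarnessLib

/-!
# The `p`-units of `ℚ(ζ_p)` modulo `q`-th powers form a free `𝔽_q[G⁺]`-module of rank one
  [Schoof2009, Proposition 13.7]

Let `p` be an odd prime, `K = ℚ(ζ_p)`, `G = Gal(K/ℚ) ≅ (ℤ/p)ˣ` (`σ_a ζ = ζ^a`), `G⁺ = G/⟨ι⟩` (cyclic of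
order `g = (p-1)/2`), `π = ζ_p - 1`, and `E_p = {ε π^m : ε ∈ (𝓞 K)ˣ, m ∈ ℤ}` the group of `p`-units.
[Schoof2009, Proposition 13.7]: *for a prime `q ∤ p(p-1)` the group `E_p/E_p^q` is a free
`𝔽_q[G⁺]`-module of rank one.* We prove it in the explicit form consumed by the plus arguments
([Schoof2009, Theorem 14.1] and Thaine's theorem [Schoof2009, Theorem 16.3]): there are a generator
`γ` of `(ℤ/p)ˣ` and a `p`-unit `u = ε₀ π^{k₀}` such that, with `σ_k = σ_{γ^k}` (`k ∈ ℤ/g`, a system of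
representatives of `G⁺`), **every `p`-unit is `∏_k σ_k(u)^{c_k}` times a `q`-th power of a `p`-unit,
and `∏_k σ_k(u)^{c_k}` is a `q`-th power of a `p`-unit only if all `q ∣ c_k`**
(`Catalan.PUnits.exists_free_generator`).

Proof (the road of [Schoof2009, Ch. 13], with Lemmas 13.3–13.5 replaced by traces):
* the coordinates `(e, m) ∈ ℤ^{g-1} × ℤ` of `ε π^m` (`e` = exponents of `ε` on Mathlib's fundamental
  system modulo torsion, Dirichlet) turn `E_p/μ_{2p}` into `ℤ^g` with `σ ∈ G` acting through the
  integer block matrices `R(σ) = [[A_σ, c_σ], [0, 1]]` (`A_σ` = `σ` on units mod torsion, `c_σ` =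
  coordinates of the unit `σ(π)/π`); `R(ι) = 1` (Kronecker: `ε^{ι-1}`, `π^{ι-1}` are roots of unity,
  [Schoof2009, Lemma 13.6]), so `k ↦ R(σ_{γ^k})` is a representation `ρ` of `ℤ/g`;
* `tr R(σ_a) = tr A_{σ_a} + 1 = #Fix(σ_a) - 1 + 1` (`UnitGalois.trace_unitsModTorsion`, Dirichlet's
  theorem as a Galois module), and `σ_a` fixes an infinite place iff `a = ±1` (the places of `K` are
  complex, the conjugation of each is `ι`): `ρ` has the regular character;
* hence (`Catalan.Semisimple.exists_linearIndependent_mulVec'`, `q ∤ g`) `𝔽_q^g = ℤ^g/q` is free of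
  rank one over `𝔽_q[ℤ/g]` on some `w`; lifting `w` to a `p`-unit `u` and using `μ_{2p} ⊆ E_p^q` gives
  the statement.

Everything is proved; the definitions are the explicit data `uσ` (the units `σ(π)/π`), `coordU`,
`Amat`, `cvec`, `Rmat`, `rho`, `rhoq` (the integer representation and its reduction), `punit`
(`ε π^m`) and `coords`.

## References

* R. Schoof, *Catalan's Conjecture*, Universitext, Springer 2009 [Schoof2009], Lemma 13.6,
  Proposition 13.7 (book pp. 89–90) — held, `lit read book:schoof2009-catalan-s-conjecture`
  (PDF pp. 167–168).
* P. Mihăilescu, *Primary cyclotomic units and a proof of Catalan's conjecture*, J. reine angew.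
  Math. **572** (2004), 167–195 [Mihailescu2004].
-/

namespace Literature.NumberTheory.DiophantineGeometry

namespace Catalan.PUnits

open NumberField NumberField.InfinitePlace NumberField.Units NumberField.Units.dirichletUnitTheorem
open Finset IsCyclotomicExtension Module
open Literature.NumberTheory.NumberFields.Stickelberger Literature.NumberTheory.NumberFields.UnitGalois
open Catalan.Minus
open scoped Classical

set_option backward.isDefEq.respectTransparency false
set_option maxSynthPendingDepth 3

variable {p : ℕ} [hp : Fact p.Prime] {K : Type*} [Field K] [NumberField K]
  [hK : IsCyclotomicExtension {p} ℚ K] {ζ : K} (hζ : IsPrimitiveRoot ζ p)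

/-! ### The places of `K` fixed by `σ_a` -/

include hζ in
/-- `ι = σ_{-1}` is the complex conjugation for every complex embedding. [cite: Schoof2009, Lemma 7.1] -/
theorem isConj_gal_neg_one (φ : K →+* ℂ) : ComplexEmbedding.IsConj φ (gal p K (-1)) := by
  unfold ComplexEmbedding.IsConj
  refine RingHom.ext fun x => ?_
  rw [ComplexEmbedding.conjugate_coe_eq, RingHom.comp_apply]
  exact (embedding_comp_gal_neg_one hζ φ x).symm

include hζ in
/-- **an infinite place of `K` is fixed by `σ_a` only if `a = ±1`.**
[cite: Schoof2009, Proposition 13.7 (proof), Exercise 13.3] -/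
theorem eq_or_eq_of_smul_eq {a : (ZMod p)ˣ} {w : InfinitePlace K} (h : gal p K a • w = w) :
    a = 1 ∨ a = -1 := by
  rw [← mk_embedding w] at h
  have hmem : gal p K a ∈ MulAction.stabilizer Gal(K/ℚ) (mk (embedding w)) := h
  rw [mem_stabilizer_mk_iff] at hmem
  rcases hmem with h1 | h1
  · left
    apply gal_injective (p := p) (K := K)
    rw [h1, gal_one]
  · right
    apply gal_injective (p := p) (K := K)
    exact h1.ext (isConj_gal_neg_one hζ (embedding w))

include hζ in
/-- no place is fixed by `σ_a`, `a ≠ ±1`. [cite: Schoof2009, Proposition 13.7 (proof)] -/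
theorem card_fixed_eq_zero {a : (ZMod p)ˣ} (ha1 : a ≠ 1) (ha2 : a ≠ -1) :
    Fintype.card {w : InfinitePlace K // gal p K a • w = w} = 0 :=
  Fintype.card_eq_zero_iff.mpr ⟨fun ⟨_, hw⟩ => by
    rcases eq_or_eq_of_smul_eq hζ hw with h | h
    · exact ha1 h
    · exact ha2 h⟩

include hζ in
/-- **the trace of `σ_a` (`a ≠ ±1`) on the units modulo torsion is `-1`.**
[cite: Schoof2009, Proposition 13.7 (proof)] -/
theorem trace_unitsModTorsion_gal {a : (ZMod p)ˣ} (ha1 : a ≠ 1) (ha2 : a ≠ -1) :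
    LinearMap.trace ℤ _ (unitsModTorsion (K := K) (gal p K a)) = -1 := by
  rw [trace_unitsModTorsion, card_fixed_eq_zero hζ ha1 ha2]
  norm_num

/-! ### `σ(π) = π u_σ` -/

/-- `σ_a(π) = π u` for a unit `u`. [cite: Schoof2009, Exercise 7.2] -/
theorem exists_unit_gal_smul_pi (a : (ZMod p)ˣ) :
    ∃ u : (𝓞 K)ˣ, gal p K a • (hζ.toInteger - 1) = (hζ.toInteger - 1) * u := by
  obtain ⟨u, hu⟩ := associated_pow_sub_one hζ (j := (a : ZMod p).val) (fun h => by
    have := Nat.le_of_dvd (ZMod.val_pos.mpr a.ne_zero) h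
    have := ZMod.val_lt (a : ZMod p)
    omega)
  refine ⟨u⁻¹, ?_⟩
  rw [smul_sub, gal_smul_toInteger hζ, smul_one, ← hu, mul_assoc, Units.mul_inv, mul_one]

/-- the unit `u_a = σ_a(π)/π = (ζ^a - 1)/(ζ - 1)`. [cite: Schoof2009, Exercise 7.2] -/
noncomputable def uσ (a : (ZMod p)ˣ) : (𝓞 K)ˣ := Classical.choose (exists_unit_gal_smul_pi hζ a)

/-- `σ_a π = π u_a`. [cite: Schoof2009, Exercise 7.2] -/
theorem gal_smul_pi (a : (ZMod p)ˣ) :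
    gal p K a • (hζ.toInteger - 1) = (hζ.toInteger - 1) * (uσ hζ a : (𝓞 K)ˣ) :=
  Classical.choose_spec (exists_unit_gal_smul_pi hζ a)

/-- `u_{ab} = u_a σ_a(u_b)`. [folklore] -/
theorem uσ_mul (a b : (ZMod p)ˣ) : uσ hζ (a * b) = uσ hζ a * unitsGal (gal p K a) (uσ hζ b) := by
  have hπ0 : hζ.toInteger - 1 ≠ 0 := (prime_zeta_sub_one hζ).ne_zero
  apply Units.ext
  apply mul_left_cancel₀ hπ0
  rw [← gal_smul_pi, gal_mul, mul_smul, gal_smul_pi, smul_mul', gal_smul_pi, Units.val_mul, mul_assoc]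
  rfl

/-- `u_1 = 1`. [folklore] -/
theorem uσ_one : uσ hζ (1 : (ZMod p)ˣ) = 1 := by
  have hπ0 : hζ.toInteger - 1 ≠ 0 := (prime_zeta_sub_one hζ).ne_zero
  apply Units.ext
  apply mul_left_cancel₀ hπ0
  rw [← gal_smul_pi, gal_one, one_smul, Units.val_one, mul_one]

/-- `u_{-1} = -ζ^{p-1}` is a root of unity. [cite: Schoof2009, Lemma 13.6 (`π^{ι-1} = -ζ^{-1}`)] -/
theorem uσ_neg_one_mem_torsion : uσ hζ (-1 : (ZMod p)ˣ) ∈ torsion K := by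
  have hπ0 : hζ.toInteger - 1 ≠ 0 := (prime_zeta_sub_one hζ).ne_zero
  have hζp : hζ.toInteger ^ p = 1 := hζ.toInteger_isPrimitiveRoot.pow_eq_one
  -- `u_{-1} = -ζ^{p-1}`
  have hval : ((uσ hζ (-1 : (ZMod p)ˣ) : (𝓞 K)ˣ) : 𝓞 K) = -hζ.toInteger ^ (p - 1) := by
    apply mul_left_cancel₀ hπ0
    rw [← gal_smul_pi, smul_sub, gal_smul_toInteger hζ, smul_one, val_neg_units, Units.val_one,
      ZMod.val_one]
    have : hζ.toInteger * hζ.toInteger ^ (p - 1) = 1 := by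
      rw [← pow_succ', Nat.sub_add_cancel hp.out.one_lt.le, hζp]
    linear_combination this
  rw [torsion, CommGroup.mem_torsion, isOfFinOrder_iff_pow_eq_one]
  refine ⟨2 * p, by have := hp.out.pos; omega, ?_⟩
  apply Units.ext
  rw [Units.val_pow_eq_pow_val, hval, Units.val_one, neg_pow, ← pow_mul,
    show (p - 1) * (2 * p) = p * (2 * (p - 1)) by ring, pow_mul, neg_one_sq, one_pow, one_mul, pow_mul,
    hζp, one_pow]

/-! ### The integer matrices `R(σ_a) = [[A_a, c_a], [0, 1]]` -/

section Matrices

/-- `A_a`: the matrix of `σ_a` on the units modulo torsion (fundamental system). [cite: Schoof2009, Proposition 13.7 (proof)] -/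
noncomputable def Amat (a : (ZMod p)ˣ) : Matrix (Fin (rank K)) (Fin (rank K)) ℤ :=
  LinearMap.toMatrix (basisModTorsion K) (basisModTorsion K) (unitsModTorsion (gal p K a))

/-- the coordinates of a unit modulo torsion. [folklore] -/
noncomputable def coordU (ε : (𝓞 K)ˣ) : Fin (rank K) → ℤ :=
  (basisModTorsion K).repr (Additive.ofMul (QuotientGroup.mk ε))

/-- `c_a`: the coordinates of `u_a`. [cite: Schoof2009, Proposition 13.7 (proof)] -/
noncomputable def cvec (a : (ZMod p)ˣ) : Fin (rank K) → ℤ := coordU (uσ hζ a)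

/-- **`R(σ_a) = [[A_a, c_a], [0, 1]]`**, the action of `σ_a` on the coordinates `(e, m)` of the
`p`-unit `ε π^m`. [cite: Schoof2009, Proposition 13.7 (proof)] -/
noncomputable def Rmat (a : (ZMod p)ˣ) : Matrix (Fin (rank K) ⊕ Unit) (Fin (rank K) ⊕ Unit) ℤ :=
  Matrix.fromBlocks (Amat (K := K) a) (Matrix.of fun i _ => cvec hζ a i) 0 1

omit hK in
/-- coordinates are additive. [folklore] -/
theorem coordU_mul (ε ε' : (𝓞 K)ˣ) : coordU (ε * ε') = coordU ε + coordU ε' := by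
  unfold coordU
  rw [QuotientGroup.mk_mul, ofMul_mul, map_add]
  rfl

omit hK in
/-- coordinates of powers. [folklore] -/
theorem coordU_pow (ε : (𝓞 K)ˣ) (k : ℕ) : coordU (ε ^ k) = k • coordU ε := by
  induction k with
  | zero =>
    unfold coordU
    rw [pow_zero, QuotientGroup.mk_one, ofMul_one, map_zero, zero_smul]
    rfl
  | succ k ih => rw [pow_succ, coordU_mul, ih, succ_nsmul]

omit hK in
/-- coordinates of `z`-powers. [folklore] -/
theorem coordU_zpow (ε : (𝓞 K)ˣ) (k : ℤ) : coordU (ε ^ k) = k • coordU ε := by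
  unfold coordU
  rw [QuotientGroup.mk_zpow, ofMul_zpow, map_zsmul]
  rfl

omit hK in
/-- torsion has zero coordinates. [folklore] -/
theorem coordU_eq_zero_of_mem_torsion {t : (𝓞 K)ˣ} (ht : t ∈ torsion K) : coordU t = 0 := by
  unfold coordU
  rw [(QuotientGroup.eq_one_iff _).mpr ht, ofMul_one, map_zero]
  rfl

omit hK in
/-- **equal coordinates ⟹ equal up to torsion**. [folklore] -/
theorem exists_torsion_of_coordU_eq {ε ε' : (𝓞 K)ˣ} (h : coordU ε = coordU ε') :
    ∃ t ∈ torsion K, ε = t * ε' := by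
  have h1 : Additive.ofMul (QuotientGroup.mk (s := torsion K) ε) =
      Additive.ofMul (QuotientGroup.mk ε') := (basisModTorsion K).repr.injective (by
    ext i
    exact congrFun h i)
  have h2 : (QuotientGroup.mk (s := torsion K) ε) = QuotientGroup.mk ε' := Additive.ofMul.injective h1
  rw [QuotientGroup.eq] at h2
  refine ⟨ε * ε'⁻¹, ?_, by rw [inv_mul_cancel_right]⟩
  have := (torsion K).inv_mem h2
  rwa [mul_inv_rev, inv_inv, mul_comm] at this

/-- **coordinates of `σ(ε)`**: `coordU (σ ε) = A_σ · coordU ε`. [folklore] -/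
theorem coordU_unitsGal (a : (ZMod p)ˣ) (ε : (𝓞 K)ˣ) :
    coordU (unitsGal (gal p K a) ε) = (Amat (K := K) a).mulVec (coordU ε) := by
  unfold coordU Amat
  rw [LinearMap.toMatrix_mulVec_repr, unitsModTorsion_apply]

omit hK in
/-- the coordinates of the fundamental units recover the exponents. [folklore] -/
theorem coordU_prod_fundSystem_zpow (e : Fin (rank K) → ℤ) :
    coordU (∏ i, fundSystem K i ^ e i) = e := by
  have h := fun_eq_repr K (x := ∏ i, fundSystem K i ^ e i) (ζ := 1) (f := e) (one_mem _) (by rw [one_mul])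
  unfold coordU
  rw [← h]

/-- `σ_στ = σ_σ σ_τ` on units modulo torsion. [folklore] -/
theorem unitsModTorsion_mul (σ τ : Gal(K/ℚ)) :
    unitsModTorsion (K := K) (σ * τ) = unitsModTorsion σ ∘ₗ unitsModTorsion τ := by
  apply (basisModTorsion K).ext
  intro i
  rw [← fundSystem_mk, LinearMap.comp_apply, unitsModTorsion_apply, unitsModTorsion_apply,
    unitsModTorsion_apply, unitsGal_mul]

/-- `σ_1 = id` on units modulo torsion. [folklore] -/
theorem unitsModTorsion_one : unitsModTorsion (K := K) (1 : Gal(K/ℚ)) = LinearMap.id := by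
  apply (basisModTorsion K).ext
  intro i
  rw [← fundSystem_mk, unitsModTorsion_apply, unitsGal_one, LinearMap.id_apply]

include hζ in
/-- **`ι` acts trivially on units modulo torsion** (Kronecker: `ε^{ι-1}` is a root of unity).
[cite: Schoof2009, Lemma 7.1 (ii), Lemma 13.6] -/
theorem unitsModTorsion_iota (hp2 : p ≠ 2) : unitsModTorsion (K := K) (gal p K (-1)) = LinearMap.id := by
  apply (basisModTorsion K).ext
  intro i
  rw [← fundSystem_mk, unitsModTorsion_apply, LinearMap.id_apply]
  congr 1
  rw [QuotientGroup.eq]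
  set f := fundSystem K i
  set ρ : (𝓞 K)ˣ := f⁻¹ * unitsGal (gal p K (-1)) f with hρ
  have h : gal p K (-1) • (f : 𝓞 K) = f * ρ := by
    rw [hρ, Units.val_mul, ← mul_assoc, Units.mul_inv, one_mul]
    rfl
  have h2p := pow_eq_one_of_smul_eq_mul hζ hp2 (Units.ne_zero f) h
  have hmem : ρ ∈ torsion K := by
    rw [torsion, CommGroup.mem_torsion, isOfFinOrder_iff_pow_eq_one]
    exact ⟨2 * p, by have := hp.out.pos; omega, h2p⟩
  have := (torsion K).inv_mem hmem
  rwa [hρ, mul_inv_rev, inv_inv] at this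

/-- `A_1 = 1`. [folklore] -/
theorem Amat_one : Amat (K := K) (1 : (ZMod p)ˣ) = 1 := by
  unfold Amat
  rw [gal_one, unitsModTorsion_one, LinearMap.toMatrix_id]

include hζ in
/-- `A_{-1} = 1`. [cite: Schoof2009, Lemma 13.6] -/
theorem Amat_neg_one (hp2 : p ≠ 2) : Amat (K := K) (-1 : (ZMod p)ˣ) = 1 := by
  unfold Amat
  rw [unitsModTorsion_iota hζ hp2, LinearMap.toMatrix_id]

/-- `A_{ab} = A_a A_b`. [folklore] -/
theorem Amat_mul (a b : (ZMod p)ˣ) : Amat (K := K) (a * b) = Amat a * Amat b := by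
  unfold Amat
  rw [gal_mul, unitsModTorsion_mul, LinearMap.toMatrix_comp (basisModTorsion K) (basisModTorsion K)]

/-- `c_1 = 0`. [folklore] -/
theorem cvec_one : cvec hζ (1 : (ZMod p)ˣ) = 0 := by
  unfold cvec
  rw [uσ_one]
  exact coordU_eq_zero_of_mem_torsion (one_mem _)

/-- `c_{-1} = 0`. [cite: Schoof2009, Lemma 13.6] -/
theorem cvec_neg_one : cvec hζ (-1 : (ZMod p)ˣ) = 0 :=
  coordU_eq_zero_of_mem_torsion (uσ_neg_one_mem_torsion hζ)

/-- `c_{ab} = c_a + A_a c_b`. [folklore] -/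
theorem cvec_mul (a b : (ZMod p)ˣ) : cvec hζ (a * b) = cvec hζ a + (Amat (K := K) a).mulVec (cvec hζ b) := by
  unfold cvec
  rw [uσ_mul, coordU_mul, coordU_unitsGal]

/-- `R(1) = 1`. [folklore] -/
theorem Rmat_one : Rmat hζ (1 : (ZMod p)ˣ) = 1 := by
  unfold Rmat
  rw [Amat_one, cvec_one, ← Matrix.fromBlocks_one]
  congr

/-- `R(-1) = 1`: `ι` acts trivially on `E_p/μ_{2p}`. [cite: Schoof2009, Lemma 13.6] -/
theorem Rmat_neg_one (hp2 : p ≠ 2) : Rmat hζ (-1 : (ZMod p)ˣ) = 1 := by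
  unfold Rmat
  rw [Amat_neg_one hζ hp2, cvec_neg_one hζ, ← Matrix.fromBlocks_one]
  congr

/-- **`R(ab) = R(a) R(b)`**. [cite: Schoof2009, Proposition 13.7 (proof)] -/
theorem Rmat_mul (a b : (ZMod p)ˣ) : Rmat hζ (a * b) = Rmat hζ a * Rmat hζ b := by
  unfold Rmat
  rw [Matrix.fromBlocks_multiply, Amat_mul, cvec_mul]
  congr 1
  · simp
  · ext i j
    simp [Matrix.mul_apply, Matrix.mulVec, dotProduct, add_comm]
  · simp
  · simp

/-- `R((-1)^m) = 1`. [folklore] -/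
theorem Rmat_neg_one_pow (hp2 : p ≠ 2) (m : ℕ) : Rmat hζ ((-1 : (ZMod p)ˣ) ^ m) = 1 := by
  induction m with
  | zero => rw [pow_zero, Rmat_one]
  | succ m ih => rw [pow_succ, Rmat_mul, ih, Rmat_neg_one hζ hp2, one_mul]

/-- **`tr R(σ) = tr A_σ + 1`**. [cite: Schoof2009, Proposition 13.7 (proof)] -/
theorem trace_Rmat (a : (ZMod p)ˣ) : (Rmat hζ a).trace = (Amat (K := K) a).trace + 1 := by
  unfold Rmat
  simp only [Matrix.trace, Matrix.diag, Fintype.sum_sum_type, Matrix.fromBlocks_apply₁₁,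
    Matrix.fromBlocks_apply₂₂, Finset.univ_unique, Finset.sum_singleton, Matrix.one_apply_eq]

/-- `tr A_a = tr(σ_a | units mod torsion)`. [folklore] -/
theorem trace_Amat (a : (ZMod p)ˣ) :
    (Amat (K := K) a).trace = LinearMap.trace ℤ _ (unitsModTorsion (K := K) (gal p K a)) := by
  unfold Amat
  rw [LinearMap.trace_eq_matrix_trace ℤ (basisModTorsion K)]

end Matrices

/-! ### The representation `ρ` of `ℤ/g` and its character -/

section Rho

variable {g : ℕ} [NeZero g] (hg : p - 1 = 2 * g) {γ : (ZMod p)ˣ} (hγ : ∀ x, x ∈ Subgroup.zpowers γ)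

include hg hγ in
omit [NeZero g] in
/-- the generator has order `2g = p - 1`. [folklore] -/
theorem orderOf_gen : orderOf γ = 2 * g := by
  rw [orderOf_eq_card_of_forall_mem_zpowers hγ, Nat.card_eq_fintype_card, ZMod.card_units, hg]

include hg hγ in
/-- `γ^g = -1`. [folklore] -/
theorem gen_pow : γ ^ g = -1 := by
  have hg0 : 0 < g := Nat.pos_of_ne_zero (NeZero.ne g)
  have h1 : (γ ^ g) ^ 2 = 1 := by rw [← pow_mul, mul_comm, ← orderOf_gen hg hγ, pow_orderOf_eq_one]
  have h2 : γ ^ g ≠ 1 := fun h => by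
    have := orderOf_dvd_of_pow_eq_one h
    rw [orderOf_gen hg hγ] at this
    have := Nat.le_of_dvd hg0 this
    omega
  have h3 : ((γ ^ g : (ZMod p)ˣ) : ZMod p) * (γ ^ g : (ZMod p)ˣ) = 1 := by
    rw [← Units.val_mul, ← sq, h1, Units.val_one]
  rcases mul_self_eq_one_iff.mp h3 with h | h
  · exact absurd (Units.ext h) h2
  · exact Units.ext (by rw [h, Units.val_neg, Units.val_one])

include hg hγ in
/-- `γ^k ≠ ±1` for `0 < k < g`. [folklore] -/
theorem gen_pow_ne {k : ℕ} (hk0 : 0 < k) (hkg : k < g) : γ ^ k ≠ 1 ∧ γ ^ k ≠ -1 := by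
  constructor
  · intro h
    have := orderOf_dvd_of_pow_eq_one h
    rw [orderOf_gen hg hγ] at this
    have := Nat.le_of_dvd hk0 this
    omega
  · intro h
    rw [← gen_pow hg hγ, pow_eq_pow_iff_modEq, orderOf_gen hg hγ] at h
    unfold Nat.ModEq at h
    rw [Nat.mod_eq_of_lt (by omega : k < 2 * g), Nat.mod_eq_of_lt (by omega : g < 2 * g)] at h
    omega

/-- **the representation of `ℤ/g ≅ G⁺` on the coordinates of `p`-units**: `ρ(k) = R(σ_{γ^k})`.
[cite: Schoof2009, Proposition 13.7 (proof)] -/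
noncomputable def rho (γ : (ZMod p)ˣ) (k : ZMod g) :
    Matrix (Fin (rank K) ⊕ Unit) (Fin (rank K) ⊕ Unit) ℤ :=
  Rmat hζ (γ ^ k.val)

omit [NeZero g] in
/-- `ρ(0) = 1`. [folklore] -/
theorem rho_zero [NeZero g] (γ : (ZMod p)ˣ) : rho hζ (g := g) γ 0 = 1 := by
  unfold rho
  rw [ZMod.val_zero, pow_zero, Rmat_one]

include hg hγ in
/-- `ρ(k + l) = ρ(k) ρ(l)` (as `R(-1) = 1`). [cite: Schoof2009, Lemma 13.6] -/
theorem rho_add (hp2 : p ≠ 2) (k l : ZMod g) : rho hζ γ (k + l) = rho hζ γ k * rho hζ γ l := by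
  unfold rho
  rw [← Rmat_mul, ← pow_add]
  have e : k.val + l.val = (k + l).val + g * ((k.val + l.val) / g) := by
    rw [ZMod.val_add]; exact (Nat.mod_add_div _ _).symm
  rw [e, pow_add, pow_mul, gen_pow hg hγ, Rmat_mul, Rmat_neg_one_pow hζ hp2, mul_one]

/-- the infinite places of the `p`-th cyclotomic field: `g = (p-1)/2` complex places. [folklore] -/
theorem card_infinitePlace (hp2 : p ≠ 2) : Fintype.card (InfinitePlace K) = (p - 1) / 2 := by
  have hp3 : 2 < p := by have := hp.out.two_le; omega
  rw [card_eq_nrRealPlaces_add_nrComplexPlaces, IsCyclotomicExtension.Rat.nrRealPlaces_eq_zero K hp3,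
    IsCyclotomicExtension.Rat.nrComplexPlaces_eq_totient_div_two p K, Nat.totient_prime hp.out, zero_add]

include hg in
/-- `rank K + 1 = g`. [folklore] -/
theorem card_index (hp2 : p ≠ 2) : Fintype.card (Fin (rank K) ⊕ Unit) = g := by
  rw [Fintype.card_sum, Fintype.card_fin, Fintype.card_unit, rank, card_infinitePlace hp2 (K := K)]
  have : 0 < g := Nat.pos_of_ne_zero (NeZero.ne g)
  omega

include hg hγ in
/-- **the character of `ρ` is the regular character**: `tr ρ(k) = g [k = 0]`.
[cite: Schoof2009, Proposition 13.7 (proof)] -/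
theorem trace_rho (hp2 : p ≠ 2) (k : ZMod g) :
    (rho hζ (K := K) γ k).trace = if k = 0 then (g : ℤ) else 0 := by
  split_ifs with hk
  · rw [hk, rho_zero, Matrix.trace_one, card_index hg hp2]
  · unfold rho
    have hk0 : 0 < k.val := Nat.pos_of_ne_zero fun h => hk ((ZMod.val_eq_zero k).mp h)
    obtain ⟨h1, h2⟩ := gen_pow_ne hg hγ hk0 (ZMod.val_lt k)
    rw [trace_Rmat, trace_Amat, trace_unitsModTorsion_gal hζ h1 h2]
    norm_num

/-- `ρ` modulo `q`. [folklore] -/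
noncomputable def rhoq (q : ℕ) (γ : (ZMod p)ˣ) (k : ZMod g) :
    Matrix (Fin (rank K) ⊕ Unit) (Fin (rank K) ⊕ Unit) (ZMod q) :=
  (rho hζ γ k).map (Int.castRingHom (ZMod q))

include hg hγ in
/-- **a vector `w ∈ 𝔽_q^g` with `{ρ(k) w}` a basis** (`Catalan.Semisimple`). [cite: Schoof2009, Proposition 13.7] -/
theorem exists_linearIndependent_rhoq (hp2 : p ≠ 2) {q : ℕ} [Fact q.Prime] (hqg : ¬ q ∣ g) :
    ∃ w : (Fin (rank K) ⊕ Unit) → ZMod q,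
      LinearIndependent (ZMod q) (fun k : ZMod g => (rhoq hζ (K := K) q γ k).mulVec w) := by
  apply Semisimple.exists_linearIndependent_mulVec' (g := g)
  · intro a b
    unfold rhoq
    rw [rho_add hζ hg hγ hp2, Matrix.map_mul]
  · intro a
    unfold rhoq
    have e : ((rho hζ (K := K) γ a).map (Int.castRingHom (ZMod q))).trace =
        Int.castRingHom (ZMod q) (rho hζ (K := K) γ a).trace := by
      simp only [Matrix.trace, Matrix.diag, Matrix.map_apply, map_sum]
    rw [e, trace_rho hζ hg hγ hp2]
    split_ifs <;> simp
  · exact hqg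

end Rho

/-! ### The `p`-units `ε π^m` and their coordinates -/

section PUnit

/-- **the `p`-unit `ε π^m`** (`π = ζ - 1`, `ε` a unit, `m ∈ ℤ`); every `p`-unit of `K = ℚ(ζ_p)` is of
this form. [cite: Schoof2009, Ch. 13 (p. 89, `E_p`)] -/
noncomputable def punit (ε : (𝓞 K)ˣ) (m : ℤ) : K :=
  ((ε : 𝓞 K) : K) * (((hζ.toInteger - 1 : 𝓞 K)) : K) ^ m

/-- the coordinates `(e, m)` of `ε π^m`. [cite: Schoof2009, Proposition 13.7 (proof)] -/
noncomputable def coords (ε : (𝓞 K)ˣ) (m : ℤ) : Fin (rank K) ⊕ Unit → ℤ :=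
  Sum.elim (coordU ε) fun _ => m

/-- `π ≠ 0` in `K`. [folklore] -/
theorem piK_ne_zero : (((hζ.toInteger - 1 : 𝓞 K)) : K) ≠ 0 := by
  have := (prime_zeta_sub_one hζ).ne_zero
  exact_mod_cast this

omit [NumberField K] hK in
/-- units are non-zero in `K`. [folklore] -/
theorem coe_unit_ne_zero (ε : (𝓞 K)ˣ) : ((ε : 𝓞 K) : K) ≠ 0 := by
  exact_mod_cast ε.ne_zero

omit [NumberField K] hK in
/-- `z`-powers of units, coerced to `K`. [folklore] -/
theorem coe_unit_zpow (u : (𝓞 K)ˣ) (m : ℤ) :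
    (((u ^ m : (𝓞 K)ˣ) : 𝓞 K) : K) = (((u : (𝓞 K)ˣ) : 𝓞 K) : K) ^ m := by
  have h := congrArg (fun x : Kˣ => (x : K)) (map_zpow (Units.map (algebraMap (𝓞 K) K : 𝓞 K →* K)) u m)
  simp only [Units.coe_map, MonoidHom.coe_coe, Units.val_zpow_eq_zpow_val] at h
  exact h

/-- `(ε π^m)(ε' π^{m'}) = (εε') π^{m+m'}`. [folklore] -/
theorem punit_mul (ε ε' : (𝓞 K)ˣ) (m m' : ℤ) :
    punit hζ (ε * ε') (m + m') = punit hζ ε m * punit hζ ε' m' := by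
  unfold punit
  rw [zpow_add₀ (piK_ne_zero hζ), Units.val_mul]
  push_cast
  ring

/-- `(ε π^m)^n = ε^n π^{nm}`. [folklore] -/
theorem punit_pow (ε : (𝓞 K)ˣ) (m : ℤ) (n : ℕ) :
    punit hζ ε m ^ n = punit hζ (ε ^ n) (n * m) := by
  induction n with
  | zero =>
    unfold punit
    simp
  | succ n ih =>
    rw [pow_succ, ih, ← punit_mul, ← pow_succ]
    congr 1
    push_cast
    ring

/-- products of `p`-units. [folklore] -/
theorem punit_prod {ι : Type*} (s : Finset ι) (ε : ι → (𝓞 K)ˣ) (m : ι → ℤ) :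
    ∏ i ∈ s, punit hζ (ε i) (m i) = punit hζ (∏ i ∈ s, ε i) (∑ i ∈ s, m i) := by
  induction s using Finset.induction_on with
  | empty =>
    unfold punit
    simp
  | insert j s hj ih => rw [Finset.prod_insert hj, Finset.prod_insert hj, Finset.sum_insert hj, ih, punit_mul]

/-- **the Galois action on `ε π^m`**: `σ_a(ε π^m) = (σ_a(ε) u_a^m) π^m`.
[cite: Schoof2009, Proposition 13.7 (proof)] -/
theorem gal_punit (a : (ZMod p)ˣ) (ε : (𝓞 K)ˣ) (m : ℤ) :
    gal p K a (punit hζ ε m) = punit hζ (unitsGal (gal p K a) ε * uσ hζ a ^ m) m := by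
  unfold punit
  have hπ : (gal p K a) (((hζ.toInteger - 1 : 𝓞 K)) : K) =
      (((hζ.toInteger - 1 : 𝓞 K)) : K) * (((uσ hζ a : (𝓞 K)ˣ) : 𝓞 K) : K) := by
    rw [← coe_gal_smul, gal_smul_pi]
    push_cast
    rfl
  rw [map_mul, map_zpow₀, hπ, mul_zpow, Units.val_mul]
  push_cast
  simp only [coe_unit_zpow]
  have e : ((gal p K a) ((ε : 𝓞 K) : K)) = (((unitsGal (gal p K a) ε : (𝓞 K)ˣ) : 𝓞 K) : K) := rfl
  rw [e]
  ring

omit hK in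
/-- coordinates are additive. [folklore] -/
theorem coords_mul (ε ε' : (𝓞 K)ˣ) (m m' : ℤ) :
    coords ε m + coords ε' m' = coords (ε * ε') (m + m') := by
  funext i
  rcases i with i | i
  · simp [coords, coordU_mul]
  · simp [coords]

omit hK in
/-- coordinates of powers. [folklore] -/
theorem coords_pow (ε : (𝓞 K)ˣ) (m : ℤ) (n : ℕ) :
    (n : ℤ) • coords ε m = coords (ε ^ n) (n * m) := by
  funext i
  rcases i with i | i
  · simp [coords, coordU_pow]
  · simp [coords]

omit hK in
/-- coordinates of products. [folklore] -/
theorem coords_prod {ι : Type*} (s : Finset ι) (ε : ι → (𝓞 K)ˣ) (m : ι → ℤ) :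
    ∑ i ∈ s, coords (ε i) (m i) = coords (∏ i ∈ s, ε i) (∑ i ∈ s, m i) := by
  induction s using Finset.induction_on with
  | empty =>
    funext i
    rcases i with i | i
    · simp [coords, coordU_eq_zero_of_mem_torsion (one_mem _)]
    · simp [coords]
  | insert j s hj ih => rw [Finset.sum_insert hj, Finset.prod_insert hj, Finset.sum_insert hj, ih, coords_mul]

/-- **`coords (σ_a ·) = R(σ_a) · coords`**. [cite: Schoof2009, Proposition 13.7 (proof)] -/
theorem coords_gal (a : (ZMod p)ˣ) (ε : (𝓞 K)ˣ) (m : ℤ) :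
    coords (unitsGal (gal p K a) ε * uσ hζ a ^ m) m = (Rmat hζ a).mulVec (coords ε m) := by
  unfold Rmat coords
  rw [Matrix.fromBlocks_mulVec, Sum.elim_comp_inl, Sum.elim_comp_inr, Matrix.zero_mulVec,
    Matrix.one_mulVec, zero_add, coordU_mul, coordU_unitsGal, coordU_zpow]
  congr 1
  funext i
  simp only [Pi.add_apply, Pi.smul_apply, smul_eq_mul, Matrix.mulVec, dotProduct, Matrix.of_apply,
    Finset.univ_unique, Finset.sum_singleton, cvec]
  ring

/-- **uniqueness of the form `ε π^m`**: `π` is not a unit. [cite: Schoof2009, Ch. 13 (p. 89)] -/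
theorem punit_injective {ε ε' : (𝓞 K)ˣ} {m m' : ℤ} (h : punit hζ ε m = punit hζ ε' m') :
    m = m' ∧ ε = ε' := by
  have hπ0 := piK_ne_zero hζ (K := K)
  have hπp := prime_zeta_sub_one hζ
  unfold punit at h
  -- `π^(m - m')` and `π^(m' - m)` in terms of units
  have key : ∀ {ε ε' : (𝓞 K)ˣ} {m m' : ℤ}, ((ε : 𝓞 K) : K) * (((hζ.toInteger - 1 : 𝓞 K)) : K) ^ m =
      ((ε' : 𝓞 K) : K) * (((hζ.toInteger - 1 : 𝓞 K)) : K) ^ m' → ¬ m' < m := by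
    intro ε ε' m m' h hlt
    obtain ⟨d, hd⟩ : ∃ d : ℕ, m = m' + (d + 1 : ℕ) := ⟨(m - m' - 1).toNat, by omega⟩
    rw [hd, zpow_add₀ hπ0, zpow_natCast] at h
    -- `ε π^(d+1) = ε'` in `𝓞 K`
    have h2 : ((ε : 𝓞 K) * (hζ.toInteger - 1) ^ (d + 1) : 𝓞 K) = (ε' : 𝓞 K) := by
      apply RingOfIntegers.ext
      have h' : ((ε : 𝓞 K) : K) * (((hζ.toInteger - 1 : 𝓞 K)) : K) ^ (d + 1) *
          (((hζ.toInteger - 1 : 𝓞 K)) : K) ^ m' = ((ε' : 𝓞 K) : K) * (((hζ.toInteger - 1 : 𝓞 K)) : K) ^ m' := by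
        linear_combination h
      have h'' := mul_right_cancel₀ (zpow_ne_zero m' hπ0) h'
      push_cast at h'' ⊢
      linear_combination h''
    have h3 : (hζ.toInteger - 1) ∣ ((ε' : (𝓞 K)ˣ) : 𝓞 K) := ⟨(ε : 𝓞 K) * (hζ.toInteger - 1) ^ d, by
      rw [← h2]; ring⟩
    exact hπp.not_unit (isUnit_of_dvd_unit h3 ε'.isUnit)
  have hmm : m = m' := by
    rcases lt_trichotomy m' m with hlt | heq | hgt
    · exact absurd hlt (key h)
    · exact heq.symm
    · exact absurd hgt (key h.symm)
  refine ⟨hmm, ?_⟩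
  subst hmm
  have h2 := mul_right_cancel₀ (zpow_ne_zero m hπ0) h
  exact Units.ext (RingOfIntegers.coe_injective h2)

omit hK in
/-- **equal coordinates ⟹ equal up to a root of unity.** [folklore] -/
theorem exists_torsion_of_coords_eq {ε ε' : (𝓞 K)ˣ} {m m' : ℤ} (h : coords ε m = coords ε' m') :
    m = m' ∧ ∃ t ∈ torsion K, ε = t * ε' := by
  constructor
  · have := congrFun h (Sum.inr ())
    simpa [coords] using this
  · apply exists_torsion_of_coordU_eq
    funext i
    have := congrFun h (Sum.inl i)
    simpa [coords] using this

/-- **roots of unity are `q`-th powers** for `q` prime to `2p`. [cite: Schoof2009, Proposition 13.7 (proof: `μ_{2p} ⊆ E_p^q`)] -/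
theorem exists_pow_eq_of_mem_torsion (hp2 : p ≠ 2) {q : ℕ} (hq : q.Coprime (2 * p)) {t : (𝓞 K)ˣ}
    (ht : t ∈ torsion K) : ∃ t₁ : (𝓞 K)ˣ, t = t₁ ^ q := by
  apply exists_eq_pow_of_pow_eq_one _ hq
  have h1 : (⟨t, ht⟩ : torsion K) ^ Nat.card (torsion K) = 1 := pow_card_eq_one'
  have h2 : Nat.card (torsion K) = 2 * p := by
    have hodd : ¬ Even p := fun he => hp2 ((Nat.Prime.even_iff hp.out).mp he)
    have := IsCyclotomicExtension.Rat.torsionOrder_eq (n := p) (K := K)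
    rw [if_neg hodd] at this
    rw [← this]
    rfl
  rw [h2] at h1
  have h3 := congrArg Subtype.val h1
  rw [Subgroup.coe_pow, Subgroup.coe_one] at h3
  exact h3

end PUnit

/-! ### Proposition 13.7 -/

section Main

variable {g : ℕ} [NeZero g] (hg : p - 1 = 2 * g)

include hg in
/-- **[Schoof2009, Proposition 13.7] — `E_p/E_p^q` is a free `𝔽_q[G⁺]`-module of rank one.**
Let `p` be an odd prime, `p - 1 = 2g`, `K = ℚ(ζ_p)`, `π = ζ_p - 1`, and `q` a prime with `q ≠ 2`,
`q ≠ p`, `q ∤ g` (i.e. `q ∤ p(p-1)`). Then there are a generator `γ` of `(ℤ/p)ˣ` and a `p`-unit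
`u = ε₀ π^{k₀}` such that, writing `σ_k = σ_{γ^k}` (`k ∈ ℤ/g`; these represent `G⁺ = G/⟨ι⟩`):
(i) every `p`-unit `ε π^m` equals `∏_k σ_k(u)^{c_k} · v^q` for some exponents `c_k ≥ 0` and some
`p`-unit `v = ε' π^{m'}`; (ii) if `∏_k σ_k(u)^{c_k}` is the `q`-th power of a `p`-unit then `q ∣ c_k`
for all `k`. In other words the classes of the `σ_k(u)` form an `𝔽_q`-basis of `E_p/E_p^q`, which is
thus free of rank one over `𝔽_q[G⁺]` on the class of `u`. [cite: Schoof2009, Proposition 13.7] -/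
theorem exists_free_generator (hp2 : p ≠ 2) {q : ℕ} [hq : Fact q.Prime] (hq2 : q ≠ 2) (hqp : q ≠ p)
    (hqg : ¬ q ∣ g) :
    ∃ (γ : (ZMod p)ˣ) (ε₀ : (𝓞 K)ˣ) (k₀ : ℤ), (∀ x, x ∈ Subgroup.zpowers γ) ∧
      (∀ (ε : (𝓞 K)ˣ) (m : ℤ), ∃ (c : ZMod g → ℕ) (ε' : (𝓞 K)ˣ) (m' : ℤ),
        punit hζ ε m =
          (∏ k : ZMod g, (gal p K (γ ^ k.val) (punit hζ ε₀ k₀)) ^ (c k)) * (punit hζ ε' m') ^ q) ∧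
      (∀ (c : ZMod g → ℕ) (ε' : (𝓞 K)ˣ) (m' : ℤ),
        (∏ k : ZMod g, (gal p K (γ ^ k.val) (punit hζ ε₀ k₀)) ^ (c k)) = (punit hζ ε' m') ^ q →
          ∀ k, q ∣ c k) := by
  have hqcop : q.Coprime (2 * p) := by
    rw [Nat.coprime_mul_iff_right]
    exact ⟨(Nat.coprime_primes hq.out Nat.prime_two).mpr hq2, (Nat.coprime_primes hq.out hp.out).mpr hqp⟩
  obtain ⟨γ, hγ⟩ := IsCyclic.exists_generator (α := (ZMod p)ˣ)
  obtain ⟨w, hw⟩ := exists_linearIndependent_rhoq hζ hg hγ hp2 (q := q) hqg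
  -- integer lift of `w` and the `p`-unit `u = ε₀ π^{k₀}` with coordinates `W`
  set W : Fin (rank K) ⊕ Unit → ℤ := fun i => ((w i).val : ℤ) with hW
  have hWred : ∀ i, ((W i : ℤ) : ZMod q) = w i := fun i => by
    show (((w i).val : ℤ) : ZMod q) = w i
    rw [Int.cast_natCast, ZMod.natCast_zmod_val]
  set ε₀ : (𝓞 K)ˣ := ∏ i, fundSystem K i ^ (W (Sum.inl i)) with hε₀
  set k₀ : ℤ := W (Sum.inr ()) with hk₀
  have hcoords₀ : coords ε₀ k₀ = W := by
    funext i
    rcases i with i | i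
    · simp only [coords, Sum.elim_inl]
      rw [hε₀, coordU_prod_fundSystem_zpow]
    · simp only [coords, Sum.elim_inr, hk₀]
  -- the conjugates `σ_k(u)` and their products
  set gε : ZMod g → (𝓞 K)ˣ := fun k => unitsGal (gal p K (γ ^ k.val)) ε₀ * uσ hζ (γ ^ k.val) ^ k₀
    with hgε
  have hσu : ∀ k : ZMod g, gal p K (γ ^ k.val) (punit hζ ε₀ k₀) = punit hζ (gε k) k₀ :=
    fun k => gal_punit hζ _ _ _
  have hprod : ∀ c : ZMod g → ℕ, ∏ k, (gal p K (γ ^ k.val) (punit hζ ε₀ k₀)) ^ c k =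
      punit hζ (∏ k, gε k ^ c k) (∑ k, (c k : ℤ) * k₀) := by
    intro c
    rw [← punit_prod]
    exact Finset.prod_congr rfl fun k _ => by rw [hσu, punit_pow]
  have hcoords_prod : ∀ c : ZMod g → ℕ,
      coords (∏ k, gε k ^ c k) (∑ k, (c k : ℤ) * k₀) = ∑ k, (c k : ℤ) • (rho hζ γ k).mulVec W := by
    intro c
    rw [← coords_prod]
    refine Finset.sum_congr rfl fun k _ => ?_
    rw [← coords_pow, hgε]
    show (c k : ℤ) • coords (unitsGal (gal p K (γ ^ k.val)) ε₀ * uσ hζ (γ ^ k.val) ^ k₀) k₀ = _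
    rw [coords_gal, hcoords₀]
    rfl
  -- reduction modulo `q`
  have hred_mulVec : ∀ (k : ZMod g) (i : Fin (rank K) ⊕ Unit),
      (((rho hζ γ k).mulVec W i : ℤ) : ZMod q) = (rhoq hζ q γ k).mulVec w i := by
    intro k i
    have h := RingHom.map_mulVec (Int.castRingHom (ZMod q)) (rho hζ γ k) W i
    rw [eq_intCast] at h
    rw [h]
    unfold rhoq
    congr 1
    funext j
    exact hWred j
  have hredS : ∀ c : ZMod g → ℤ, ∀ i, (((∑ k, c k • (rho hζ γ k).mulVec W) i : ℤ) : ZMod q) =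
      (∑ k, ((c k : ℤ) : ZMod q) • (rhoq hζ q γ k).mulVec w) i := by
    intro c i
    simp only [Finset.sum_apply, Pi.smul_apply, smul_eq_mul, Int.cast_sum, Int.cast_mul]
    exact Finset.sum_congr rfl fun k _ => by rw [hred_mulVec]
  refine ⟨γ, ε₀, k₀, hγ, ?_, ?_⟩
  · -- (i) spanning
    intro ε m
    have hcard : Fintype.card (ZMod g) = Module.finrank (ZMod q) (Fin (rank K) ⊕ Unit → ZMod q) := by
      rw [ZMod.card, Module.finrank_fintype_fun_eq_card, card_index hg hp2]
    let Bw := basisOfLinearIndependentOfCardEqFinrank hw hcard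
    set X : Fin (rank K) ⊕ Unit → ℤ := coords ε m with hX
    set xq : Fin (rank K) ⊕ Unit → ZMod q := fun i => (X i : ZMod q) with hxq
    set cq : ZMod g → ZMod q := fun k => Bw.repr xq k with hcq
    set c : ZMod g → ℕ := fun k => (cq k).val with hc
    have hsum : ∑ k, cq k • (rhoq hζ q γ k).mulVec w = xq := by
      have h := Bw.sum_repr xq
      rw [← h]
      refine Finset.sum_congr rfl fun k _ => ?_
      rw [hcq, coe_basisOfLinearIndependentOfCardEqFinrank]
    set S : Fin (rank K) ⊕ Unit → ℤ := ∑ k, (c k : ℤ) • (rho hζ γ k).mulVec W with hS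
    have hcast : ∀ k, (((c k : ℕ) : ℤ) : ZMod q) = cq k := fun k => by
      show ((((cq k).val : ℕ) : ℤ) : ZMod q) = cq k
      rw [Int.cast_natCast, ZMod.natCast_zmod_val]
    have hdvd : ∀ i, (q : ℤ) ∣ X i - S i := by
      intro i
      rw [← ZMod.intCast_zmod_eq_zero_iff_dvd]
      push_cast
      rw [hS, hredS, sub_eq_zero]
      simp_rw [hcast]
      rw [hsum]
    choose Y hY using hdvd
    set εY : (𝓞 K)ˣ := ∏ i, fundSystem K i ^ (Y (Sum.inl i)) with hεY
    set mY : ℤ := Y (Sum.inr ()) with hmY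
    have hcoordsY : coords εY mY = Y := by
      funext i
      rcases i with i | i
      · simp only [coords, Sum.elim_inl]
        rw [hεY, coordU_prod_fundSystem_zpow]
      · simp only [coords, Sum.elim_inr, hmY]
    have hE : coords ε m = coords ((∏ k, gε k ^ c k) * εY ^ q) ((∑ k, (c k : ℤ) * k₀) + q * mY) := by
      rw [← coords_mul, hcoords_prod, ← coords_pow, hcoordsY, ← hS]
      funext i
      simp only [Pi.add_apply, Pi.smul_apply, smul_eq_mul]
      have := hY i
      rw [← hX]
      linarith
    obtain ⟨hm, t, ht, hεt⟩ := exists_torsion_of_coords_eq hE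
    obtain ⟨t₁, rfl⟩ := exists_pow_eq_of_mem_torsion hp2 hqcop ht
    refine ⟨c, t₁ * εY, mY, ?_⟩
    rw [hprod, punit_pow, ← punit_mul, hεt, hm]
    congr 1
    rw [mul_pow, mul_left_comm]
  · -- (ii) independence
    intro c ε' m' h
    rw [hprod, punit_pow] at h
    obtain ⟨hm, hE⟩ := punit_injective hζ h
    have hco : coords (∏ k, gε k ^ c k) (∑ k, (c k : ℤ) * k₀) = coords (ε' ^ q) (∑ k, (c k : ℤ) * k₀) := by
      rw [hE]
    rw [hcoords_prod, hm, ← coords_pow] at hco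
    -- modulo `q`
    have hrel : ∑ k, ((c k : ℤ) : ZMod q) • (rhoq hζ q γ k).mulVec w = 0 := by
      funext i
      rw [← hredS, hco]
      simp only [Pi.smul_apply, smul_eq_mul, Pi.zero_apply]
      push_cast
      rw [ZMod.natCast_self, zero_mul]
    intro k
    have hli := Fintype.linearIndependent_iff.mp hw (fun k => ((c k : ℤ) : ZMod q)) hrel k
    simp only [Int.cast_natCast] at hli
    exact (ZMod.natCast_eq_zero_iff (c k) q).mp hli

end Main

end Catalan.PUnits

end Literature.NumberTheory.DiophantineGeometry
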